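import Literature.AlgebraicGeometry.Resolution.AlterationsSingFitting
import Literature.AlgebraicGeometry.Resolution.StalkSpecializesLocalization
import Literature.RingTheory.FittingIdeal.LocalRing
import Mathlib.RingTheory.HopkinsLevitzki
import Mathlib.RingTheory.Etale.Kaehler
import Mathlib.RingTheory.Unramified.Basic
import HarnessLib

/-!
# De Jong's alteration theorem: `2 ≤ n_T < ∞` from the structure of `Sing(f)` (de Jong 1996, 3.4) — proof

Topic: `Literature/AlgebraicGeometry/Resolution`. Assembles the named fact
`DeJong1996SemiStableThickness` of `AlterationsSemiStableThickness.lean` (de Jong 1996, 3.4: at a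
non-regular point `x` with `dim 𝒪_{X,x} ≤ 2` of the curve `f : X → Y` of a pair in Situation
4.23 — the generic point of a codimension-2 component `T` of `Sing(X)` — the local ring
`𝒪_{X,x}/Fitt₁(Ω_{X/Y})_x` of the singular scheme `Sing(f)` (2.21) has finite length
`n_T ≥ 2`) from two stalkwise properties of `Sing(f)` vendored in `AlterationsSingFitting.lean`
(2.21: `Sing(f) → S` is unramified; 3.1 / Stacks 01V9: the smooth locus is the complement of
`Sing(f)`) and the two-generation of `Fitt₁(Ω_{X/Y})_x` at the non-regular points of the curve of
a pair (2.23, Remark: "the trace of `Sing(f)` on the scheme `Spec B` is given by the ideal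
`(u, v) ⊂ B`"), taken as an explicit hypothesis:

* `DeJong1996SemiStableThickness.of_singFitting` — THE ASSEMBLY. With `B = 𝒪_{X,x}`,
  `A = 𝒪_{Y,f x}`, `I = Fitt₁(Ω_{B/A})`: `dim B = 2` (`DeJong1996SemiStableSingCodimTwo_holds`);
  `I ≠ B`, for otherwise `Ω_{B/A}` is cyclic (Stacks 07ZC over the local ring `B`,
  `Literature.RingTheory.FittingIdeal.Module.fittingIdeal_one_eq_top_iff`), `f` is smooth at `x`
  (`DeJong1996SmoothIffDifferentialsCyclic`, Stacks 01V9) and `B` is regular (3.1); `𝔪_B ⊄ I`,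
  for otherwise `𝔪_B = I` is generated by two elements (2.23, Remark, the hypothesis) while
  `dim B = 2` and `B` is not regular; hence `ℓ(B/I) ≥ 2`. And `ℓ(B/I) < ∞`: a prime
  `Q ⊇ I` containing `𝔪_A B` contains `I + 𝔪_A B ⊇ 𝔪_B` (`DeJong1996SingUnramified`, 2.21),
  while a prime `Q ⊇ I` not containing `𝔪_A B` is the prime of a generization `x' ⤳ x`
  (`StalkSpecializesLocalization.lean`) lying over the generic point of the one-dimensional
  regular local ring `A` (`dim B = dim A + dim 𝒪_{X_{f x},x}`, EGA IV₂ 6.1.2, with a fibre ring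
  of positive dimension), i.e. over `Y ∖ D`, where `f` is smooth, `Ω_{X/Y,x'}` is cyclic
  (01V9), and `I ⊄ Q` by Stacks 07ZC along the localization `B → B_Q = 𝒪_{X,x'}` — so `B/I`
  is Artinian;
* the glue, proved: `two_le_length_quotient`, `length_quotient_ne_top_of_forall_isPrime`,
  `exists_mem_fittingIdeal_notMem_of_specializes` (`Fitt₁(Ω_{X/Y})_x ⊄ 𝔭_{x'}` when `Ω_{X/Y,x'}`
  is cyclic), `notMem_of_isField_stalk`, `exists_smooth_of_notMem`, `ringKrullDim_base_le_one`.

All three inputs are discharged in the tree: the two facts of `AlterationsSingFitting.lean`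
(general — any base, any point — stalkwise statements) by `DeJong1996SingUnramified_holds`
(`AlterationsSingFittingProofs.lean`) and `DeJong1996SmoothIffDifferentialsCyclic_holds`
(`AlterationsSingFittingSmoothProofs.lean`), and the hypothesis by
`DeJong1996.SemiStablePair.exists_singFittingIdeal_eq_span_pair`
(`AlterationsSemiStableThicknessHolds.lean`: the split formal structure of 2.23 with its Remark at
a closed point `x₀ ∈ cl{x}` of `Sing(f)` — `DeJong1996.SemiStablePair.map_singFittingIdeal_eq_span`
with `exists_ringEquiv_nodeDeformationRing` —, descent of two generators along
`𝒪_{X,x₀} → 𝒪̂_{X,x₀}`, and localization to `x`), which file also carries the discharge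
`DeJong1996SemiStableThickness_holds`. (The hypothesis was first vendored as a named fact in the
printed generality of 2.23 — any semi-stable curve over a locally Noetherian base, any point —,
which needs the non-split local description, the finite étale `A → A'` and the quadratic form
`Q`, absent from the tree; its split review, D-0026, merged it back into this assembly in the
form actually consumed.) A declared parallel reduction of the fact,
`AlterationsSemiStableNodeStructure.lean`, reduces it instead to the normal form of 3.3 at `η_T`
(`DeJong1996SemiStableThickness.of_nodeLocalStructureCodimTwo`, from
`DeJong1996NodeLocalStructureCodimTwo`).

## Sources

* A. J. de Jong, *Smoothness, semi-stability and alterations*, Publ. Math. IHÉS 83 (1996),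
  2.21, 2.23 (pp. 61–62), 3.1–3.4 (pp. 62–64), 4.23 (p. 75).
* The Stacks Project, Tags 01V9, 07ZC, 0C3I, 01J7.
* A. Grothendieck, J. Dieudonné, *EGA IV₂*, Cor. 6.1.2 (via
  `Motives.coheight_eq_coheight_add_ringKrullDim_stalk_fiber`); *EGA IV₄* 17.5.8 (iii) (via
  `SemiStablePair.isRegularLocalRing_of_smooth`).
-/

noncomputable section

open CategoryTheory CategoryTheory.Limits AlgebraicGeometry TopologicalSpace IsLocalRing Order

namespace Literature.AlgebraicGeometry.Resolution

universe u

/-! ## Local algebra: the length of `B/I` over a local ring -/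

section LocalAlgebra

variable {B : Type u} [CommRing B] [IsLocalRing B]

/-- Over a local ring `(B, 𝔪)`, a proper ideal `I` not containing `𝔪` has `ℓ_B(B/I) ≥ 2`: the
chain `0 < 𝔪/I < B/I`. [folklore] -/
theorem two_le_length_quotient (I : Ideal B) (hI : I ≠ ⊤) (hm : ¬ maximalIdeal B ≤ I) :
    (2 : ℕ∞) ≤ Module.length B (B ⧸ I) := by
  let J : Submodule B (B ⧸ I) := Submodule.map (Submodule.mkQ I) (maximalIdeal B)
  have hJbot : J ≠ ⊥ := by
    intro hJ
    apply hm
    have : Submodule.map (Submodule.mkQ I) (maximalIdeal B) ≤ ⊥ := hJ.le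
    rw [Submodule.map_le_iff_le_comap, Submodule.comap_bot, Submodule.ker_mkQ] at this
    exact this
  have hJtop : J ≠ ⊤ := by
    intro hJ
    have h1 : Submodule.comap (Submodule.mkQ I) J = maximalIdeal B := by
      show Submodule.comap (Submodule.mkQ I) (Submodule.map (Submodule.mkQ I) (maximalIdeal B)) =
        maximalIdeal B
      rw [Submodule.comap_map_eq, Submodule.ker_mkQ, sup_eq_left.mpr (le_maximalIdeal hI)]
    rw [hJ, Submodule.comap_top] at h1
    exact (maximalIdeal.isMaximal B).ne_top h1.symm
  have hadd := Module.length_eq_add_of_exact J.subtype J.mkQ (Submodule.injective_subtype J)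
    (Submodule.mkQ_surjective J) (LinearMap.exact_subtype_mkQ J)
  haveI : Nontrivial J := Submodule.nontrivial_iff_ne_bot.mpr hJbot
  haveI : Nontrivial ((B ⧸ I) ⧸ J) := Submodule.Quotient.nontrivial_iff.mpr hJtop
  have h1 : (1 : ℕ∞) ≤ Module.length B J := Order.one_le_iff_pos.mpr Module.length_pos
  have h2 : (1 : ℕ∞) ≤ Module.length B ((B ⧸ I) ⧸ J) := Order.one_le_iff_pos.mpr Module.length_pos
  rw [hadd]
  exact add_le_add h1 h2

/-- Over a Noetherian local ring `(B, 𝔪)`, if every prime containing the ideal `I` is `𝔪`,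
then `B/I` is Artinian and `ℓ_B(B/I) < ∞`. [folklore] -/
theorem length_quotient_ne_top_of_forall_isPrime [IsNoetherianRing B] (I : Ideal B)
    (h : ∀ Q : Ideal B, Q.IsPrime → I ≤ Q → Q = maximalIdeal B) :
    Module.length B (B ⧸ I) ≠ ⊤ := by
  by_cases hI : I = ⊤
  · haveI : Subsingleton (B ⧸ I) := Ideal.Quotient.subsingleton_iff.mpr hI
    rw [Module.length_eq_zero]
    exact ENat.zero_ne_top
  haveI : Nontrivial (B ⧸ I) := Ideal.Quotient.nontrivial_iff.mpr hI
  haveI : Ring.KrullDimLE 0 (B ⧸ I) := by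
    rw [Ring.krullDimLE_zero_iff]
    intro Q' hQ'
    have hQ : Q'.comap (Ideal.Quotient.mk I) = maximalIdeal B :=
      h _ (Ideal.IsPrime.comap _) ((Ideal.mk_ker (I := I)).symm.le.trans (Ideal.ker_le_comap _))
    have hQ'eq : Q' = (maximalIdeal B).map (Ideal.Quotient.mk I) := by
      rw [← hQ, Ideal.map_comap_of_surjective _ Ideal.Quotient.mk_surjective]
    rcases Ideal.map_eq_top_or_isMaximal_of_surjective (Ideal.Quotient.mk I)
      Ideal.Quotient.mk_surjective (maximalIdeal.isMaximal B) with htop | hmax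
    · exact absurd (hQ'eq.trans htop) hQ'.ne_top
    · rwa [← hQ'eq] at hmax
  haveI : IsArtinianRing (B ⧸ I) := IsNoetherianRing.isArtinianRing_of_krullDimLE_zero
  rw [Module.length_eq_of_surjective (S := B) (R := B ⧸ I) (M := B ⧸ I)
    (by rw [Ideal.Quotient.algebraMap_eq]; exact Ideal.Quotient.mk_surjective)]
  exact Module.length_ne_top

end LocalAlgebra

/-! ## Kähler differentials and Fitting ideals of the stalks along a generization -/

/-- Let `f : X → Y` be locally of finite type and `x' ⤳ x` in `X`. If the stalk
`Ω_{X/Y,x'} = Ω_{𝒪_{X,x'}/𝒪_{Y,f x'}}` at the generization is cyclic, then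
`Fitt₁(Ω_{𝒪_{X,x}/𝒪_{Y,f x}})` is not contained in the prime `𝔭_{x'} ⊆ 𝒪_{X,x}` of `x'`:
`𝒪_{X,x'} = (𝒪_{X,x})_{𝔭_{x'}}` and `𝒪_{Y,f x'}` is a localization of `𝒪_{Y,f x}`
(`StalkSpecializesLocalization.lean`), Kähler differentials commute with localization and are
unchanged by localizing the base (`Ω_{𝒪_{Y,fx'}/𝒪_{Y,fx}} = 0`), and Stacks 07ZC
(`Literature.RingTheory.FittingIdeal.Module.exists_mem_fittingIdeal_notMem`). This is the
stalkwise form of "the formation of `Sing(f) = V(Fitt₁ Ω_{X/S})` is compatible with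
generization". [cite: StacksProject, Tag 0C3I] -/
theorem exists_mem_fittingIdeal_notMem_of_specializes {X Y : Scheme.{u}} (f : X ⟶ Y)
    [LocallyOfFiniteType f] {x x' : X} (h : x' ⤳ x)
    (hcyc : letI : Algebra (Y.presheaf.stalk (f x')) (X.presheaf.stalk x') :=
        (f.stalkMap x').hom.toAlgebra;
      ∃ ω' : KaehlerDifferential (Y.presheaf.stalk (f x')) (X.presheaf.stalk x'),
        Submodule.span (X.presheaf.stalk x') {ω'} = ⊤) :
    letI : Algebra (Y.presheaf.stalk (f x)) (X.presheaf.stalk x) := (f.stalkMap x).hom.toAlgebra;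
    ∃ d ∈ Literature.RingTheory.FittingIdeal.Module.fittingIdeal (X.presheaf.stalk x)
        (KaehlerDifferential (Y.presheaf.stalk (f x)) (X.presheaf.stalk x)) 1,
      d ∉ (maximalIdeal (X.presheaf.stalk x')).comap (X.presheaf.stalkSpecializes h).hom := by
  -- the four local rings and the commutative square of stalk maps
  let A := Y.presheaf.stalk (f x)
  let B := X.presheaf.stalk x
  let A' := Y.presheaf.stalk (f x')
  let B' := X.presheaf.stalk x'
  have hy : f x' ⤳ f x := h.map f.continuous
  letI algAB : Algebra A B := (f.stalkMap x).hom.toAlgebra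
  letI algA'B' : Algebra A' B' := (f.stalkMap x').hom.toAlgebra
  letI algBB' : Algebra B B' := (X.presheaf.stalkSpecializes h).hom.toAlgebra
  letI algAA' : Algebra A A' := (Y.presheaf.stalkSpecializes hy).hom.toAlgebra
  letI algAB' : Algebra A B' :=
    ((X.presheaf.stalkSpecializes h).hom.comp (f.stalkMap x).hom).toAlgebra
  haveI towerABB' : IsScalarTower A B B' := IsScalarTower.of_algebraMap_eq' rfl
  haveI towerAA'B' : IsScalarTower A A' B' := IsScalarTower.of_algebraMap_eq' (by
    show (X.presheaf.stalkSpecializes h).hom.comp (f.stalkMap x).hom =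
      (f.stalkMap x').hom.comp (Y.presheaf.stalkSpecializes hy).hom
    rw [← CommRingCat.hom_comp, ← CommRingCat.hom_comp, Scheme.Hom.stalkSpecializes_stalkMap])
  obtain ⟨ω', hω'⟩ := hcyc
  -- `B'` is the localization of `B` at `P`, `A'` a localization of `A`
  let P : Ideal B := (maximalIdeal B').comap (X.presheaf.stalkSpecializes h).hom
  haveI : IsLocalization.AtPrime B' P := isLocalizationAtPrime_stalkSpecializes h
  let Q : Ideal A := (maximalIdeal A').comap (Y.presheaf.stalkSpecializes hy).hom
  haveI : IsLocalization.AtPrime A' Q := isLocalizationAtPrime_stalkSpecializes hy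
  -- `Ω_{A'/A} = 0`, so `Ω_{B'/A} → Ω_{B'/A'}` is an isomorphism and `Ω_{B'/A}` is cyclic
  haveI : Algebra.FormallyUnramified A A' :=
    Algebra.FormallyUnramified.of_isLocalization Q.primeCompl
  have hinj : Function.Injective (KaehlerDifferential.map A A' B' B') := by
    rw [← LinearMap.ker_eq_bot, (KaehlerDifferential.exact_mapBaseChange_map A A' B').linearMap_ker_eq,
      LinearMap.range_eq_bot, LinearMap.ext_iff]
    intro t
    rw [LinearMap.zero_apply]
    induction t using TensorProduct.induction_on with
    | zero => exact map_zero _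
    | tmul b w => rw [Subsingleton.elim w 0, TensorProduct.tmul_zero, map_zero]
    | add a b ha hb => rw [map_add, ha, hb, add_zero]
  have hsurj : Function.Surjective (KaehlerDifferential.map A A' B' B') :=
    KaehlerDifferential.map_surjective A A' B'
  let e := LinearEquiv.ofBijective (KaehlerDifferential.map A A' B' B') ⟨hinj, hsurj⟩
  let ω : KaehlerDifferential A B' := e.symm ω'
  have hω : Submodule.span B' {ω} = ⊤ := by
    apply Submodule.map_injective_of_injective e.injective
    rw [Submodule.map_span, Set.image_singleton, Submodule.map_top, LinearEquiv.range]
    show Submodule.span B' {e (e.symm ω')} = ⊤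
    rw [LinearEquiv.apply_symm_apply, hω']
  -- `Ω_{B/A} → Ω_{B'/A}` is a localization at `P`; Stacks 07ZC
  haveI : IsLocalizedModule P.primeCompl (KaehlerDifferential.map A A B B') :=
    KaehlerDifferential.isLocalizedModule_map A B B' P.primeCompl
  haveI : Algebra.EssFiniteType A B := by
    rw [← RingHom.essFiniteType_algebraMap, RingHom.algebraMap_toAlgebra]
    exact LocallyOfFiniteType.stalkMap f x
  obtain ⟨d, hd, hdP⟩ := Literature.RingTheory.FittingIdeal.Module.exists_mem_fittingIdeal_notMem
    (M := KaehlerDifferential A B) P B' (KaehlerDifferential.map A A B B')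
    (fun _ : Fin 1 => ω) (by rw [Set.range_const]; exact hω)
  exact ⟨d, hd, hdP⟩

/-! ## The assembly: `DeJong1996SemiStableThickness` from the three inputs -/

namespace DeJong1996

namespace SemiStablePair

variable {k : Type u} [Field k] {X Y : Scheme.{u}} {f : X ⟶ Y} {g : Y ⟶ Spec (.of k)}
  {D : Set Y} {n : ℕ} {τ : Fin n → (Y ⟶ X)}

/-- In Situation 4.23, a point of `Y` whose local ring is a field is off the divisor `D` (the
local rings of `D` have dimension `r + e ≥ 1`). [folklore] -/
theorem notMem_of_isField_stalk (hS : SemiStablePair f g D τ) {y : Y}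
    (hy : IsField (Y.presheaf.stalk y)) : y ∉ D := by
  intro hyD
  obtain ⟨r, e, -, -, hr, hdim, -, -⟩ := hS.isStrictNormalCrossingsDivisor.exists_regularSystemOfParameters hyD
  rw [ringKrullDim_eq_zero_of_isField hy] at hdim
  have : (0 : WithBot ℕ∞) ≠ ((r + e : ℕ) : WithBot ℕ∞) := by
    have hne : (0 : ℕ) ≠ r + e := by omega
    exact_mod_cast hne
  exact this hdim

/-- In Situation 4.23, `f` is smooth on the open `f⁻¹(Y ∖ D)`; in particular every point over
`Y ∖ D` has an open neighbourhood on which `f` is smooth. [cite: DeJong1996, 4.23, p. 75] -/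
theorem exists_smooth_of_notMem (hS : SemiStablePair f g D τ) {x : X} (hx : f x ∉ D) :
    ∃ U : X.Opens, x ∈ U ∧ Smooth (U.ι ≫ f) := by
  let V : Y.Opens := ⟨Dᶜ, hS.isStrictNormalCrossingsDivisor.isClosed.isOpen_compl⟩
  haveI : Smooth (f ∣_ V) := hS.smooth_morphismRestrict
  refine ⟨f ⁻¹ᵁ V, hx, ?_⟩
  rw [← morphismRestrict_ι]
  infer_instance

/-- In Situation 4.23, at a point `x` with `dim 𝒪_{X,x} ≤ 2` which is not regular, the base
local ring `𝒪_{Y, f x}` has dimension `≤ 1` (it is `dim 𝒪_{X,x} - dim 𝒪_{X_{f x}, x}` by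
flatness, EGA IV₂ 6.1.2, and the fibre local ring has positive dimension, else `x` would be
regular, Matsumura 23.7 (ii)). [folklore] -/
theorem ringKrullDim_base_le_one (hS : SemiStablePair f g D τ) {x : X}
    (hx : x ∈ Scheme.singularLocusCodimLE X 2) :
    ringKrullDim (Y.presheaf.stalk (f x)) ≤ 1 := by
  haveI := hS.isIntegral
  haveI := hS.isNoetherian
  haveI := hS.isNoetherian_base
  haveI : Flat f := hS.isSemiStableCurve.flat
  haveI := hS.isSemiStableCurve.locallyOfFiniteType
  -- the fibre is reduced and locally Noetherian; its local ring at `x` has `dim ≥ 1`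
  haveI : IsReduced (f.fiber (f x)) := hS.isSemiStableCurve.isReduced_fiber (f x)
  haveI : LocallyOfFiniteType (f.fiberToSpecResidueField (f x)) :=
    MorphismProperty.pullback_snd _ _ inferInstance
  haveI : IsLocallyNoetherian (f.fiber (f x)) :=
    LocallyOfFiniteType.isLocallyNoetherian (f.fiberToSpecResidueField (f x))
  have hR1 : (1 : WithBot ℕ∞) ≤ ringKrullDim ((f.fiber (f x)).presheaf.stalk (f.asFiber x)) := by
    by_contra hlt
    have hle := ringKrullDim_le_zero_of_not_one_le
      ((f.fiber (f x)).presheaf.stalk (f.asFiber x)) hlt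
    haveI : Ring.KrullDimLE 0 ((f.fiber (f x)).presheaf.stalk (f.asFiber x)) :=
      Ring.krullDimLE_iff.mpr hle
    have hF : IsField ((f.fiber (f x)).presheaf.stalk (f.asFiber x)) :=
      Ring.KrullDimLE.isField_of_isReduced
    exact hx.1 (isRegularLocalRing_stalk_of_isField_stalk_fiber f x (hS.isRegular_base _) hF)
  -- EGA IV₂ 6.1.2
  have h3 := Literature.AlgebraicGeometry.Motives.coheight_eq_coheight_add_ringKrullDim_stalk_fiber f x
  have h2 : (coheight x : WithBot ℕ∞) ≤ 2 := by
    rw [← ringKrullDim_stalk_eq_coheight]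
    exact hx.2
  obtain ⟨a, ha⟩ := exists_ringKrullDim_eq_natCast (Y.presheaf.stalk (f x))
  obtain ⟨c, hc⟩ := exists_ringKrullDim_eq_natCast ((f.fiber (f x)).presheaf.stalk (f.asFiber x))
  rw [ringKrullDim_stalk_eq_coheight] at ha
  rw [ha, hc] at h3
  rw [h3] at h2
  rw [hc] at hR1
  rw [ringKrullDim_stalk_eq_coheight, ha]
  have h1c : 1 ≤ c := by exact_mod_cast hR1
  have hac : a + c ≤ 2 := by exact_mod_cast h2
  exact_mod_cast (show a ≤ 1 by omega)

end SemiStablePair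

end DeJong1996

/-- **de Jong 1996, 3.4: `2 ≤ n_T < ∞` — `DeJong1996SemiStableThickness` from the three inputs
`DeJong1996SingUnramified` (2.21), `DeJong1996SmoothIffDifferentialsCyclic` (3.1 / Stacks 01V9)
and the two-generation of `Fitt₁(Ω_{X/Y})_x` at the non-regular points of the curve of a pair
(2.23, Remark — the hypothesis `h3`, discharged by
`DeJong1996.SemiStablePair.exists_singFittingIdeal_eq_span_pair`,
`AlterationsSemiStableThicknessHolds.lean`).** Let `x` be a non-regular point of `X` with
`dim B ≤ 2`, `B = 𝒪_{X,x}`, `A = 𝒪_{Y, f x}`, `I = Fitt₁(Ω_{B/A})`; then `dim B = 2` (3.4,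
`DeJong1996SemiStableSingCodimTwo_holds`).
* `I ≠ B`: otherwise `Ω_{B/A}` is cyclic (Stacks 07ZC), `f` is smooth at `x` (01V9) and `B` is
  regular (3.1, EGA IV₄ 17.5.8 (iii)).
* `𝔪_B ⊄ I`: otherwise `𝔪_B = I = (a, b)` (2.23) is generated by `2 = dim B` elements and `B` is
  regular. Hence `ℓ(B/I) ≥ 2` (the chain `0 < 𝔪_B/I < B/I`).
* `ℓ(B/I) < ∞`: every prime `Q ⊇ I` of `B` is `𝔪_B`, so `B/I` is Artinian. Indeed if
  `𝔪_A B ⊆ Q` then `Q ⊇ I + 𝔪_A B ⊇ 𝔪_B` (2.21: `Sing(f) → S` is unramified); if not, `Q` is the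
  prime of a generization `x' ⤳ x` lying over the generic point of the discrete valuation ring
  `A` (`dim A = 1`: `dim B = dim A + dim 𝒪_{X_{fx},x}` with a positive-dimensional fibre ring),
  i.e. over `Y ∖ D`, where `f` is smooth; so `Ω_{X/Y,x'}` is cyclic (01V9) and `I ⊄ Q`
  (07ZC along the localization `B → 𝒪_{X,x'} = B_Q`), a contradiction.
[cite: DeJong1996, 3.4, p. 63] -/
theorem DeJong1996SemiStableThickness.of_singFitting (h1 : DeJong1996SingUnramified.{u})
    (h2 : DeJong1996SmoothIffDifferentialsCyclic.{u})
    (h3 : ∀ (k : Type u) [Field k] [IsAlgClosed k] (X Y : Scheme.{u}) (f : X ⟶ Y)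
      (g : Y ⟶ Spec (.of k)) (D : Set Y) (n : ℕ) (τ : Fin n → (Y ⟶ X)),
      DeJong1996.SemiStablePair f g D τ → ∀ x : X, ¬ IsRegularLocalRing (X.presheaf.stalk x) →
        ∃ a b : X.presheaf.stalk x, Scheme.Hom.singFittingIdeal f x = Ideal.span {a, b}) :
    DeJong1996SemiStableThickness.{u} := by
  intro k _ _ X Y f g D n τ hS x hx
  haveI := hS.isIntegral
  haveI := hS.isNoetherian
  haveI := hS.isNoetherian_base
  haveI : Flat f := hS.isSemiStableCurve.flat
  haveI := hS.isSemiStableCurve.locallyOfFiniteType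
  -- the local rings `A → B` and the ideal `I = Fitt₁(Ω_{B/A})`
  let A := Y.presheaf.stalk (f x)
  let B := X.presheaf.stalk x
  letI algAB : Algebra A B := (f.stalkMap x).hom.toAlgebra
  haveI : IsLocalHom (algebraMap A B) := inferInstanceAs (IsLocalHom (f.stalkMap x).hom)
  haveI : Algebra.EssFiniteType A B := by
    rw [← RingHom.essFiniteType_algebraMap, RingHom.algebraMap_toAlgebra]
    exact LocallyOfFiniteType.stalkMap f x
  let I : Ideal B := Scheme.Hom.singFittingIdeal f x
  have hI : I = Literature.RingTheory.FittingIdeal.Module.fittingIdeal B (KaehlerDifferential A B) 1 :=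
    rfl
  have hreg : ¬ IsRegularLocalRing B := hx.1
  have hdim2 : ringKrullDim B = 2 :=
    le_antisymm hx.2 (DeJong1996SemiStableSingCodimTwo_holds k X Y f g D n τ hS x hx.1)
  -- (1) `I ≠ B`
  have hItop : I ≠ ⊤ := by
    intro htop
    rw [hI] at htop
    obtain ⟨ω, hω⟩ :=
      (Literature.RingTheory.FittingIdeal.Module.fittingIdeal_one_eq_top_iff (R := B)
        (M := KaehlerDifferential A B)).mp htop
    obtain ⟨U, hxU, hU⟩ := (h2 X Y f hS.isSemiStableCurve x).mpr ⟨ω, hω⟩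
    exact hreg (hS.isRegularLocalRing_of_smooth hU hxU)
  -- (2) `𝔪_B ⊄ I`
  have hmI : ¬ maximalIdeal B ≤ I := by
    intro hle
    obtain ⟨a, b, hab⟩ := h3 k X Y f g D n τ hS x hreg
    have hmeq : maximalIdeal B = Ideal.span {a, b} := by
      rw [← hab]
      exact le_antisymm hle (le_maximalIdeal hItop)
    apply hreg
    refine IsRegularLocalRing.of_spanFinrank_maximalIdeal_le B ?_
    rw [hdim2, hmeq]
    have hle2 : (Ideal.span {a, b}).spanFinrank ≤ ({a, b} : Set B).ncard :=
      Submodule.spanFinrank_span_le_ncard_of_finite (Set.toFinite _)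
    have h2' : ({a, b} : Set B).ncard ≤ 2 := by
      calc ({a, b} : Set B).ncard ≤ ({b} : Set B).ncard + 1 := Set.ncard_insert_le a {b}
        _ = 2 := by rw [Set.ncard_singleton]
    exact_mod_cast hle2.trans h2'
  -- (3) every prime over `I` is `𝔪_B`
  have hprime : ∀ Q : Ideal B, Q.IsPrime → I ≤ Q → Q = maximalIdeal B := by
    intro Q hQ hIQ
    by_cases hmA : (maximalIdeal A).map (algebraMap A B) ≤ Q
    · have h1x := (h1 X Y f hS.isSemiStableCurve x hItop).1
      exact le_antisymm (le_maximalIdeal hQ.ne_top) (h1x.trans (sup_le hIQ hmA))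
    · exfalso
      -- the generization `x'` of `x` with prime `Q`, and its image `f x'`
      obtain ⟨x', hx', hQeq⟩ := exists_specializes_comap_stalkSpecializes_eq x Q
      have hy' : f x' ⤳ f x := hx'.map f.continuous
      let A' := Y.presheaf.stalk (f x')
      let B' := X.presheaf.stalk x'
      letI algAA' : Algebra A A' := (Y.presheaf.stalkSpecializes hy').hom.toAlgebra
      let QA : Ideal A := (maximalIdeal A').comap (Y.presheaf.stalkSpecializes hy').hom
      haveI : IsLocalization.AtPrime A' QA := isLocalizationAtPrime_stalkSpecializes hy'
      -- `QA = Q ∩ A` is a prime of `A` other than `𝔪_A`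
      have hQA : QA = Q.comap (algebraMap A B) := by
        rw [hQeq, Ideal.comap_comap]
        show (maximalIdeal A').comap (Y.presheaf.stalkSpecializes hy').hom =
          (maximalIdeal B').comap ((X.presheaf.stalkSpecializes hx').hom.comp (f.stalkMap x).hom)
        rw [← IsLocalRing.maximalIdeal_comap (f.stalkMap x').hom, Ideal.comap_comap,
          ← CommRingCat.hom_comp, ← CommRingCat.hom_comp, Scheme.Hom.stalkSpecializes_stalkMap]
      have hQAne : QA ≠ maximalIdeal A := by
        intro heq
        apply hmA
        rw [Ideal.map_le_iff_le_comap, ← hQA, heq]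
      -- `dim A ≤ 1` and `A` is a regular local ring, hence a domain: so `QA = ⊥`
      haveI : IsRegularLocalRing A := hS.isRegular_base (f x)
      haveI : IsDomain A := isDomain_of_isRegularLocalRing A
      haveI : Ring.KrullDimLE 1 A := Ring.krullDimLE_iff.mpr (hS.ringKrullDim_base_le_one hx)
      have hQAbot : QA = ⊥ := by
        by_contra hne
        exact hQAne (IsLocalRing.eq_maximalIdeal
          (Ideal.IsPrime.isMaximal_of_ne_bot (Ideal.IsPrime.comap _) hne))
      -- so `A' = 𝒪_{Y, f x'}` is a field and `f x' ∉ D`: `f` is smooth at `x'`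
      have hA'field : IsField A' := by
        rw [IsLocalRing.isField_iff_maximalIdeal_eq]
        have := IsLocalization.map_under QA.primeCompl (S := A') (maximalIdeal A')
        rw [Ideal.under, show (maximalIdeal A').comap (algebraMap A A') = QA from rfl, hQAbot,
          Ideal.map_bot] at this
        exact this.symm
      have hxD : f x' ∉ D := hS.notMem_of_isField_stalk hA'field
      obtain ⟨U, hx'U, hU⟩ := hS.exists_smooth_of_notMem hxD
      have hcyc := (h2 X Y f hS.isSemiStableCurve x').mp ⟨U, hx'U, hU⟩
      -- 07ZC along `B → B_Q = 𝒪_{X,x'}`: `I ⊄ Q`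
      obtain ⟨d, hd, hdQ⟩ := exists_mem_fittingIdeal_notMem_of_specializes f hx' hcyc
      rw [← hQeq] at hdQ
      exact hdQ (hIQ (hI ▸ hd))
  -- conclusion
  show (2 : ℕ∞) ≤ Module.length B (B ⧸ I) ∧ Module.length B (B ⧸ I) ≠ ⊤
  exact ⟨two_le_length_quotient I hItop hmI, length_quotient_ne_top_of_forall_isPrime I hprime⟩

end Literature.AlgebraicGeometry.Resolution

end
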